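import Mathlib
import Summits.ResolutionOfSingularities.ResolutionOfSingularities.Theorems.RadicialJungCleanModelsCleanProp44NearLineExplicit
import Summits.ResolutionOfSingularities.ResolutionOfSingularities.Theorems.RadicialJungCleanModelsCleanProp44NearLineCornerCoeff
import Summits.ResolutionOfSingularities.ResolutionOfSingularities.Theorems.RadicialJungCleanModelsCleanProp44NearLineOfCleanRegAt
import HarnessLib

/-!
# Route `RadicialJung`, crux `CleanModels` (stmt-ResolutionOfSingularities-15917), line `Sketch` rev 35, stub 6 `stub_cleanProp44` (X44c):
# CLEAN-PERMISSIBILITY OF NEAR LINES, XVI — everything read on the data at the blown-up point: vertices and cross lines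

Seat decomp-res-hand-2 g18 (structural hand).  The endpoint of lemma (ii): ✓ `cleanPermissibleAt_nearLine_or_corner_or_cross` (`…NearLineExplicit`) with the
corner disjunct replaced through ✓ `corner_nearLine_coefficients` (`…NearLineCornerCoeff`).  For a threefold point `x` (`c : Fin 3`-indexed clean data
`(c, u, a)`, every `a_k` zero or prime to `p`) blown up by `τ`, and the near line `N = (e', y')` of `y = Σ_k m_k c_k` at a point `x'` over `x`
(`dim 𝒪_{x'} = 3`):

* (appended) `cleanPermissibleAt_nearLine_or_vertex_or_cross_of_cleanRegAt` — the same straight from `CleanRegAt` at `x` and the near-line data as the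
  tree serves it (`IsRsopPart ![e', y']`), producing the clean normal form `(c, cc, u, a)` and the coefficients `m` itself.
* `cleanPermissibleAt_nearLine_or_vertex_or_cross` — the line of `τ♯G` is CLEAN-PERMISSIBLE at `x'` for `N`, OR [VERTEX] for some ordering
  `{i, k₁, k₂} = Fin 3`: `a_{k₁} ≠ 0`, `a_{k₂} ≠ 0`, BOTH sides `V(c_{k₁})`, `V(c_{k₂})` pass through `x'` (`(τ♯c_{k_j}) ≠ 𝔪_x𝒪_{x'}`), `m_i ∈ 𝔪_x` and
  `m_{k₁}, m_{k₂} ∉ 𝔪_x` (the near line passes through the vertex `V_i` and is not a side there), OR [CROSS] `p ∣ Σ a`, no side through `x'`, and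
  some cross hypersurface `V(a_{k₁}m_{k₂}c_{k₂} − a_{k₂}m_{k₁}c_{k₁})` passes through `x'`.

So the set of points of a near line where it is not clean-permissible is contained in {the ≤ 3 vertices it passes through as a non-side,
each needing two effective sides} ∪ {its points on the cross lines, only when `p ∣ Σ a`} — all decided by `(a, m mod 𝔪_x)`, i.e. by the position
of the near line in `E_x = ℙ(𝔪_x/𝔪_x²)` relative to the clean triangle.  Honest framing: OURS; a TOOL for the (R1ᵐⁱⁿ)/(R3ᵐⁱⁿ′) provers; counts and
termination NOT addressed.  Nothing here proves X44c, any case of `CleanModels`, or resolution of singularities in characteristic `p`.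
Setting only: [cite: CossartPiltant2008, Lemma 4.3 (5); Prop. 4.4] [cite: Piltant2013, §2 Axiom 4].
-/

noncomputable section

set_option linter.dupNamespace false -- mandated namespace of this single-conjunct summit

open IsLocalRing CategoryTheory AlgebraicGeometry
open Literature.AlgebraicGeometry.Resolution Literature.AlgebraicGeometry.Motives

namespace Summit.ResolutionOfSingularities.ResolutionOfSingularities.Theorems.RadicialJung.CleanModels

universe u

/-- In `Fin 3` two distinct indices have a unique third one. [folklore] -/
theorem exists_third_fin_three (k₁ k₂ : Fin 3) (hk : k₁ ≠ k₂) : ∃ i : Fin 3, i ≠ k₁ ∧ i ≠ k₂ ∧ ∀ k, k = i ∨ k = k₁ ∨ k = k₂ := by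
  revert k₁ k₂
  decide

section Scheme

variable {p : ℕ} {X X' : Scheme.{u}} [IsIntegral X] [IsIntegral X'] {τ : X' ⟶ X} [IsDominant τ] {J : X.IdealSheafData}

set_option maxHeartbeats 800000 in
-- long statement, short proof
/-- **Vertices and cross lines: the obstruction set of a near line read on the data at the blown-up point.**  See the module docstring.
[cite: CossartPiltant2008, Lemma 4.3 (5); Prop. 4.4 (proof, p. 11)] [cite: Piltant2013, §2 Axiom 4] -/
theorem cleanPermissibleAt_nearLine_or_vertex_or_cross [Fact p.Prime] [CharP X.functionField p] (hτ : IsBlowup τ J) (x' : X')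
    (hR : IsRegularLocalRing (X.presheaf.stalk (τ x'))) (c : Fin 3 → X.presheaf.stalk (τ x'))
    (hc : Ideal.span (Set.range c) = maximalIdeal (X.presheaf.stalk (τ x')))
    (hdim : ringKrullDim (X.presheaf.stalk (τ x')) = (3 : ℕ)) (hJ : stalkIdeal J (τ x') = maximalIdeal (X.presheaf.stalk (τ x')))
    {G : X.functionField} {cc : Fin p → X.functionField} (hcc : ∃ j : Fin p, (j : ℕ) ≠ 0 ∧ cc j ≠ 0)
    {u : X.presheaf.stalk (τ x')} (hu : IsUnit u) {a : Fin 3 → ℕ}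
    (hrep : (∑ j : Fin p, cc j ^ p * G ^ (j : ℕ)) = RatFn.toFunctionField (τ x') (u * ∏ k, c k ^ a k))
    (hall : ∀ k, a k = 0 ∨ ¬ p ∣ a k) (hdim' : ringKrullDim (X'.presheaf.stalk x') = 3)
    {d : ℕ} (t : Fin d → X.presheaf.stalk (τ x')) (hspan : Ideal.span (Set.range t) = maximalIdeal (X.presheaf.stalk (τ x')))
    (hdimd : ringKrullDim (X.presheaf.stalk (τ x')) = (d : WithBot ℕ∞)) (j₀ : Fin d) (m : Fin 3 → X.presheaf.stalk (τ x'))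
    (hy : t j₀ = ∑ k, m k * c k) {e' y' z' : X'.presheaf.stalk x'}
    (he' : Ideal.span {e'} = (maximalIdeal (X.presheaf.stalk (τ x'))).map (τ.stalkMap x').hom)
    (hy' : (τ.stalkMap x').hom (t j₀) = e' * y') (hy'm : y' ∈ maximalIdeal (X'.presheaf.stalk x'))
    (hzz : Ideal.span ({e', y', z'} : Set (X'.presheaf.stalk x')) = maximalIdeal (X'.presheaf.stalk x')) :
    CleanPermissibleAt p (RatFn.toFunctionField x') (RatFn.functionFieldMap τ G) (Ideal.span ({e', y'} : Set (X'.presheaf.stalk x'))) ∨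
    (∃ i k₁ k₂ : Fin 3, i ≠ k₁ ∧ i ≠ k₂ ∧ k₁ ≠ k₂ ∧ a k₁ ≠ 0 ∧ a k₂ ≠ 0 ∧
        Ideal.span {(τ.stalkMap x').hom (c k₁)} ≠ (maximalIdeal (X.presheaf.stalk (τ x'))).map (τ.stalkMap x').hom ∧
        Ideal.span {(τ.stalkMap x').hom (c k₂)} ≠ (maximalIdeal (X.presheaf.stalk (τ x'))).map (τ.stalkMap x').hom ∧
        m i ∈ maximalIdeal (X.presheaf.stalk (τ x')) ∧ m k₁ ∉ maximalIdeal (X.presheaf.stalk (τ x')) ∧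
        m k₂ ∉ maximalIdeal (X.presheaf.stalk (τ x'))) ∨
    (p ∣ ∑ k, a k ∧ (∀ k, a k ≠ 0 → Ideal.span {(τ.stalkMap x').hom (c k)} = (maximalIdeal (X.presheaf.stalk (τ x'))).map (τ.stalkMap x').hom) ∧
      ∃ k₁ k₂ : Fin 3, k₁ ≠ k₂ ∧
        Ideal.span {(τ.stalkMap x').hom ((a k₁ : X.presheaf.stalk (τ x')) * (m k₂ * c k₂) - (a k₂ : X.presheaf.stalk (τ x')) * (m k₁ * c k₁))} ≠
          (maximalIdeal (X.presheaf.stalk (τ x'))).map (τ.stalkMap x').hom) := by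
  classical
  rcases cleanPermissibleAt_nearLine_or_corner_or_cross hτ x' hR le_rfl c hc hdim hJ hcc hu hrep hall hdim' t hspan hdimd j₀ m hy he' hy' hy'm
      hzz with h | ⟨k₁, k₂, s₁, s₂, hk, hak₁, hak₂, hs₁, hs₂, hss, hs₁N, hs₂N⟩ | h
  · exact Or.inl h
  · right; left
    obtain ⟨i, hik₁, hik₂, huniv⟩ := exists_third_fin_three k₁ k₂ hk
    -- `𝒪_{x'}` is a regular local domain and `(e', y')` is part of a regular system of parameters
    obtain ⟨_, _, _, _, -, -, -, -, -, hrsop, -⟩ :=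
      exists_transform_normalForm_of_isBlowup hτ x' hR c Fin.elim0 (by
        rw [Fin.append_elim0]
        have hsurj : Function.Surjective (Fin.cast (Nat.add_zero 3)) := fun i => ⟨Fin.cast (Nat.add_zero 3).symm i, Fin.ext rfl⟩
        rw [hsurj.range_comp, hc]) (by rw [Nat.add_zero]; exact hdim) (hc.trans hJ.symm) a Fin.elim0 hu
    have hR' : IsRegularLocalRing (X'.presheaf.stalk x') := hrsop.isRegularLocalRing
    haveI := isDomain_of_isRegularLocalRing (X'.presheaf.stalk x')
    have hpair : IsRsopPart (Fin.append ![e'] ![y']) := by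
      refine ⟨hR', 1, ![z'], by rw [hdim']; norm_cast, ?_⟩
      have h1 : Set.range (Fin.append ![e'] ![y']) ∪ Set.range ![z'] = {e', y', z'} := by
        have happ : (Fin.append ![e'] ![y'] : Fin 2 → X'.presheaf.stalk x') = ![e', y'] := by funext r; fin_cases r <;> rfl
        rw [happ]
        ext r
        simp only [Set.mem_insert_iff, Set.mem_singleton_iff, Matrix.range_cons, Matrix.range_empty, Set.union_empty, Set.union_singleton]
        tauto
      rw [h1, hzz]
    have he'm : e' ∈ maximalIdeal (X'.presheaf.stalk x') := hzz ▸ Ideal.subset_span (by simp)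
    have hs₁m : s₁ ∈ maximalIdeal (X'.presheaf.stalk x') := hss ▸ Ideal.subset_span (by simp)
    have hs₂m : s₂ ∈ maximalIdeal (X'.presheaf.stalk x') := hss ▸ Ideal.subset_span (by simp)
    have he'0 : e' ≠ 0 := by
      have h1 := hpair.ne_zero 0
      have h2 : (Fin.append ![e'] ![y'] : Fin 2 → X'.presheaf.stalk x') 0 = e' := rfl
      rwa [h2] at h1
    have hy'' : (τ.stalkMap x').hom (∑ k, m k * c k) = e' * y' := by rw [← hy]; exact hy'
    obtain ⟨hmi, hm₁, hm₂⟩ := corner_nearLine_coefficients (τ.stalkMap x').hom he'.symm he'0 c m hc hik₁ hik₂ hk huniv hy'' hpair hs₁ hs₂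
      hs₁m hs₂m hs₁N hs₂N
    -- the two sides pass through `x'`
    have hpass : ∀ {k : Fin 3} {s : X'.presheaf.stalk x'}, (τ.stalkMap x').hom (c k) = e' * s → s ∈ maximalIdeal (X'.presheaf.stalk x') →
        Ideal.span {(τ.stalkMap x').hom (c k)} ≠ (maximalIdeal (X.presheaf.stalk (τ x'))).map (τ.stalkMap x').hom := by
      intro k s hs hsm hspan
      rw [hs, ← he'] at hspan
      exact mem_nonunits_iff.mp ((mem_maximalIdeal _).mp hsm) (isUnit_of_span_singleton_mul_eq he'0 hspan)
    exact ⟨i, k₁, k₂, hik₁, hik₂, hk, hak₁, hak₂, hpass hs₁ hs₁m, hpass hs₂ hs₂m, hmi, hm₁, hm₂⟩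
  · exact Or.inr (Or.inr h)

set_option maxHeartbeats 800000 in
-- long statement, short proof
/-- **Lemma (ii), the consumer's endpoint: on a near line of the blowing up of a clean-regular threefold point, the obstruction set is read on the
clean normal form at the point (vertices of the clean triangle on the line, cross lines).**  See the module docstring.
[cite: CossartPiltant2008, Lemma 4.3 (5); Prop. 4.4 (proof, p. 11)] [cite: Piltant2013, §2 Axiom 4] -/
theorem cleanPermissibleAt_nearLine_or_vertex_or_cross_of_cleanRegAt [Fact p.Prime] [CharP X.functionField p] (hτ : IsBlowup τ J) (x' : X')
    (hJ : stalkIdeal J (τ x') = maximalIdeal (X.presheaf.stalk (τ x'))) {G : X.functionField}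
    (hclean : CleanRegAt p (RatFn.toFunctionField (τ x')) G) (hdim3 : ringKrullDim (X.presheaf.stalk (τ x')) = (3 : ℕ))
    (hdim' : ringKrullDim (X'.presheaf.stalk x') = 3)
    {d : ℕ} (t : Fin d → X.presheaf.stalk (τ x')) (hspan : Ideal.span (Set.range t) = maximalIdeal (X.presheaf.stalk (τ x')))
    (hdimd : ringKrullDim (X.presheaf.stalk (τ x')) = (d : WithBot ℕ∞)) (j₀ : Fin d) {e' y' : X'.presheaf.stalk x'}
    (he' : Ideal.span {e'} = (maximalIdeal (X.presheaf.stalk (τ x'))).map (τ.stalkMap x').hom)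
    (hy' : (τ.stalkMap x').hom (t j₀) = e' * y') (hpair : IsRsopPart ![e', y']) :
    ∃ (c : Fin 3 → X.presheaf.stalk (τ x')) (cc : Fin p → X.functionField) (u : X.presheaf.stalk (τ x')) (a : Fin 3 → ℕ)
      (m : Fin 3 → X.presheaf.stalk (τ x')),
      Ideal.span (Set.range c) = maximalIdeal (X.presheaf.stalk (τ x')) ∧ (∃ j : Fin p, (j : ℕ) ≠ 0 ∧ cc j ≠ 0) ∧ IsUnit u ∧
      (∀ k, a k = 0 ∨ ¬ p ∣ a k) ∧ (∑ j : Fin p, cc j ^ p * G ^ (j : ℕ)) = RatFn.toFunctionField (τ x') (u * ∏ k, c k ^ a k) ∧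
      t j₀ = ∑ k, m k * c k ∧
      (CleanPermissibleAt p (RatFn.toFunctionField x') (RatFn.functionFieldMap τ G) (Ideal.span ({e', y'} : Set (X'.presheaf.stalk x'))) ∨
      (∃ i k₁ k₂ : Fin 3, i ≠ k₁ ∧ i ≠ k₂ ∧ k₁ ≠ k₂ ∧ a k₁ ≠ 0 ∧ a k₂ ≠ 0 ∧
          Ideal.span {(τ.stalkMap x').hom (c k₁)} ≠ (maximalIdeal (X.presheaf.stalk (τ x'))).map (τ.stalkMap x').hom ∧
          Ideal.span {(τ.stalkMap x').hom (c k₂)} ≠ (maximalIdeal (X.presheaf.stalk (τ x'))).map (τ.stalkMap x').hom ∧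
          m i ∈ maximalIdeal (X.presheaf.stalk (τ x')) ∧ m k₁ ∉ maximalIdeal (X.presheaf.stalk (τ x')) ∧
          m k₂ ∉ maximalIdeal (X.presheaf.stalk (τ x'))) ∨
      (p ∣ ∑ k, a k ∧ (∀ k, a k ≠ 0 → Ideal.span {(τ.stalkMap x').hom (c k)} = (maximalIdeal (X.presheaf.stalk (τ x'))).map (τ.stalkMap x').hom) ∧
        ∃ k₁ k₂ : Fin 3, k₁ ≠ k₂ ∧
          Ideal.span {(τ.stalkMap x').hom ((a k₁ : X.presheaf.stalk (τ x')) * (m k₂ * c k₂) - (a k₂ : X.presheaf.stalk (τ x')) * (m k₁ * c k₁))} ≠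
            (maximalIdeal (X.presheaf.stalk (τ x'))).map (τ.stalkMap x').hom)) := by
  classical
  obtain ⟨hR, n, c, cc, u, a, hc, hdim, hcc, hu, hall, hrep⟩ := exists_cleanRegAt_normalForm p (RatFn.toFunctionField (τ x')) hclean
  -- `n = 3`
  have hn : n = 3 := by
    have h1 := hdim.symm.trans hdim3
    exact_mod_cast h1
  subst hn
  -- the coefficients of `t_{j₀}` in the basis `c`
  have hy𝔪 : t j₀ ∈ Ideal.span (Set.range c) := hc ▸ hspan ▸ Ideal.subset_span ⟨j₀, rfl⟩
  obtain ⟨m, hm⟩ := Ideal.mem_span_range_iff_exists_fun.mp hy𝔪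
  -- the third parameter and `y' ∈ 𝔪'`
  obtain ⟨z', hzz⟩ := exists_span_triple_eq_of_isRsopPart_pair hpair hdim'
  have hy'm : y' ∈ maximalIdeal (X'.presheaf.stalk x') := by simpa using hpair.mem_maximalIdeal 1
  refine ⟨c, cc, u, a, m, hc, hcc, hu, hall, hrep, hm.symm, ?_⟩
  exact cleanPermissibleAt_nearLine_or_vertex_or_cross hτ x' hR c hc hdim hJ hcc hu hrep hall hdim' t hspan hdimd j₀ m hm.symm he' hy' hy'm hzz

end Scheme

end Summit.ResolutionOfSingularities.ResolutionOfSingularities.Theorems.RadicialJung.CleanModels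

end
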